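import Mathlib
import Summits.KontsevichZagierPeriods.KontsevichZagierPeriods.Theorems.HyperbolicBlochZagierDilogarithmConjectureStubBorelSlice
import HarnessLib

/-!
# `ZagierDilogarithmConjecture` (stmt-KontsevichZagierPeriods-10550) — line
`kummer-clausen-linearisation` (reshape c1), by-product `stub_imagQuadraticSlice`

**The imaginary-quadratic slice of Zagier's conjecture**, with the field hypothesis of
`stub_borelSlice` discharged: for points `zᵢ = aᵢ + bᵢ√(−d)` (`aᵢ, bᵢ ∈ ℚ`, `d ∈ ℕ`) of the upper
half plane whose formal combination has zero Dehn invariant, `Σ nᵢ D(zᵢ) = 0` implies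
`Σ nᵢ[zᵢ] ∈ ⟨dilogRelators⟩`, given Dupont 2001 Thm. 10.24 a). The field `ℚ(√−d) = ℚ(α)`,
`α = √d·i`, is finite over `ℚ` and every embedding `ℚ(α) → ℂ` is the inclusion or its conjugate
(`σ(α)² = −d` forces `σ(α) = ±α`, and a ring homomorphism on `ℚ(α)` is determined by its value at
`α`: `ringHom_ext_adjoin_singleton`, by `IntermediateField.adjoin_induction`). This covers the route's
calibrations `5D(ρ) = 6D(2ρ)`, `3D(ω) = 2D(ρ)` (`ℚ(√−3)`) and the `ℚ(i)`-relations found by the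
drefuter's LLL sweep (`2D((4+3i)/5) + 3D((3+4i)/5) + D((−3+4i)/5) = 6G`, kit j013275), all of which
have zero Dehn invariant. Sorry-free; conditional only on the named fact (explicit hypothesis).
-/

noncomputable section

open scoped BigOperators ComplexConjugate
open Literature.NumberTheory.Transcendental
open FreeAbelianGroup (of lift_apply_of)
open Summit.KontsevichZagierPeriods.HyperbolicBloch.ZagierDilogarithmConjectureNegative
  (ext ext_of_ne sym asym dehn dehn_of)

namespace Summit.KontsevichZagierPeriods.HyperbolicBloch.ZagierDilogarithmBorelSlice

/-! ## §5 Imaginary quadratic fields: one complex place, hence inside the slice -/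

section imagQuadratic

/-- Two ring homomorphisms `ℚ(α) → ℂ` that agree at `α` agree everywhere. [folklore] -/
theorem ringHom_ext_adjoin_singleton (α : ℂ) (σ τ : IntermediateField.adjoin ℚ ({α} : Set ℂ) →+* ℂ)
    (h : ∀ hα : α ∈ IntermediateField.adjoin ℚ ({α} : Set ℂ), σ ⟨α, hα⟩ = τ ⟨α, hα⟩)
    (x : IntermediateField.adjoin ℚ ({α} : Set ℂ)) : σ x = τ x := by
  obtain ⟨x, hx⟩ := x
  induction hx using IntermediateField.adjoin_induction with
  | mem x hx =>
    rw [Set.mem_singleton_iff] at hx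
    subst hx
    exact h _
  | algebraMap q =>
    have e : (⟨algebraMap ℚ ℂ q, IntermediateField.algebraMap_mem _ q⟩ :
        IntermediateField.adjoin ℚ ({α} : Set ℂ)) = (q : IntermediateField.adjoin ℚ ({α} : Set ℂ)) :=
      Subtype.ext (by push_cast; exact eq_ratCast _ q)
    rw [e, map_ratCast, map_ratCast]
  | add x y hx hy ihx ihy =>
    have e : (⟨x + y, add_mem hx hy⟩ : IntermediateField.adjoin ℚ ({α} : Set ℂ)) = ⟨x, hx⟩ + ⟨y, hy⟩ :=
      rfl
    rw [e, map_add, map_add, ihx, ihy]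
  | inv x hx ihx =>
    have e : (⟨x⁻¹, inv_mem hx⟩ : IntermediateField.adjoin ℚ ({α} : Set ℂ)) = ⟨x, hx⟩⁻¹ := rfl
    rw [e, map_inv₀, map_inv₀, ihx]
  | mul x y hx hy ihx ihy =>
    have e : (⟨x * y, mul_mem hx hy⟩ : IntermediateField.adjoin ℚ ({α} : Set ℂ)) = ⟨x, hx⟩ * ⟨y, hy⟩ :=
      rfl
    rw [e, map_mul, map_mul, ihx, ihy]

/-- For `α ∈ ℂ` with `α² = −d` (`d ∈ ℕ`) and `ᾱ = −α`, the field `ℚ(α) ⊂ ℂ` is finite over `ℚ`, closed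
under complex conjugation, and every embedding `ℚ(α) → ℂ` is the inclusion or its conjugate (so `ℚ(α)`
has exactly one complex place). [folklore] -/
theorem imagQuadratic_onePlace (d : ℕ) (α : ℂ) (hα2 : α ^ 2 = -(d : ℂ)) (hαc : conj α = -α) :
    FiniteDimensional ℚ (IntermediateField.adjoin ℚ ({α} : Set ℂ)) ∧
      (∀ x : ℂ, x ∈ IntermediateField.adjoin ℚ ({α} : Set ℂ) →
        (starRingEnd ℂ) x ∈ IntermediateField.adjoin ℚ ({α} : Set ℂ)) ∧
      ∀ σ : IntermediateField.adjoin ℚ ({α} : Set ℂ) →+* ℂ,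
        (∀ x : IntermediateField.adjoin ℚ ({α} : Set ℂ), σ x = (x : ℂ)) ∨
        (∀ x : IntermediateField.adjoin ℚ ({α} : Set ℂ), σ x = (starRingEnd ℂ) (x : ℂ)) ∨
        (∀ x : IntermediateField.adjoin ℚ ({α} : Set ℂ), (σ x).im = 0) := by
  classical
  set K : IntermediateField ℚ ℂ := IntermediateField.adjoin ℚ ({α} : Set ℂ) with hKdef
  have hαK : α ∈ K := IntermediateField.subset_adjoin ℚ _ (Set.mem_singleton α)
  -- integrality: `α` is a root of `X² + d`
  have hint : IsIntegral ℚ α := by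
    refine ⟨Polynomial.X ^ 2 + Polynomial.C (d : ℚ), Polynomial.monic_X_pow_add_C _ two_ne_zero, ?_⟩
    simp [hα2]
  have hfd : FiniteDimensional ℚ K := IntermediateField.adjoin.finiteDimensional hint
  -- complex conjugation as a `ℚ`-algebra endomorphism of `ℂ`
  let c : ℂ →ₐ[ℚ] ℂ := (starRingEnd ℂ).toRatAlgHom
  have hc : ∀ x, c x = conj x := fun _ => rfl
  have hmap : K.map c ≤ K := by
    rw [hKdef, IntermediateField.adjoin_map, Set.image_singleton, hc, hαc]
    exact IntermediateField.adjoin_simple_le_iff.2 (neg_mem hαK)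
  have hKc : ∀ x : ℂ, x ∈ K → conj x ∈ K := fun x hx =>
    hmap ((IntermediateField.mem_map K).2 ⟨x, hx, rfl⟩)
  refine ⟨hfd, hKc, fun σ => ?_⟩
  -- embeddings: `σ(α)² = −d`, so `σ(α) = ±α`
  have hgen2 : ((⟨α, hαK⟩ : K) : K) ^ 2 = -((d : ℚ) : K) := by
    apply Subtype.ext
    push_cast
    exact hα2
  have hsq : (σ ⟨α, hαK⟩) ^ 2 = α ^ 2 := by
    rw [← map_pow, hgen2, hα2, map_neg, map_ratCast]
    push_cast
    rfl
  -- complex conjugation composed with the inclusion, as a ring hom `K → ℂ`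
  let τc : K →+* ℂ := (starRingEnd ℂ).comp (algebraMap K ℂ)
  rcases sq_eq_sq_iff_eq_or_eq_neg.1 hsq with h | h
  · left
    intro x
    have := ringHom_ext_adjoin_singleton α σ (algebraMap K ℂ) (fun hα => ?_) x
    · simpa using this
    · rw [IntermediateField.algebraMap_apply]
      exact h
  · right; left
    intro x
    have := ringHom_ext_adjoin_singleton α σ τc (fun hα => ?_) x
    · simpa [τc] using this
    · show σ ⟨α, hα⟩ = conj (algebraMap K ℂ ⟨α, hα⟩)
      rw [IntermediateField.algebraMap_apply, h]
      exact hαc.symm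

/-- **The imaginary-quadratic slice of Zagier's conjecture** (an instance of `stub_borelSlice` with the
field discharged): for points `zᵢ = aᵢ + bᵢ√(−d)` (`aᵢ, bᵢ ∈ ℚ`, `d ∈ ℕ`) in the upper half plane whose
formal combination `Σ nᵢ[zᵢ]` has zero Dehn invariant, `Σ nᵢ D(zᵢ) = 0` implies `Σ nᵢ[zᵢ] ∈ ⟨dilogRelators⟩`,
GIVEN Dupont 2001 Thm. 10.24 a). Covers the route's calibrations (`5D(ρ) = 6D(2ρ)`, `3D(ω) = 2D(ρ)`, the
`ℚ(i)`-relations `2D((4+3i)/5) + 3D((3+4i)/5) + D((−3+4i)/5) = 6G`). [cite: Dupont2001, Thm. 10.24 a)] -/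
theorem stub_imagQuadraticSlice :
    Dupont2001_preBloch_relation_of_invariants →
    ∀ (d : ℕ) (k : ℕ) (z : Fin k → ℂ) (n : Fin k → ℤ),
      (∀ i, ∃ a b : ℚ, z i = a + b * (Real.sqrt d * Complex.I)) → (∀ i, 0 < (z i).im) →
      (∀ u v : Additive ℂˣ →+ ℚ, dehn u v (∑ i, n i • FreeAbelianGroup.of (z i)) = 0) →
      ∑ i, (n i : ℝ) * blochWignerDilog (z i) = 0 →
        (∑ i, n i • FreeAbelianGroup.of (z i)) ∈ AddSubgroup.closure dilogRelators := by
  intro hD d k z n hz him hdehn hsum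
  set α : ℂ := (Real.sqrt d : ℂ) * Complex.I with hαdef
  have hα2 : α ^ 2 = -(d : ℂ) := by
    have h1 : ((Real.sqrt d : ℝ) : ℂ) ^ 2 = (d : ℂ) := by
      rw [← Complex.ofReal_pow, Real.sq_sqrt (Nat.cast_nonneg d)]
      push_cast
      rfl
    rw [hαdef, mul_pow, Complex.I_sq, h1]
    ring
  have hαc : conj α = -α := by
    rw [hαdef, map_mul, Complex.conj_ofReal, Complex.conj_I]
    ring
  obtain ⟨hfd, -, hKσ⟩ := imagQuadratic_onePlace d α hα2 hαc
  set K : IntermediateField ℚ ℂ := IntermediateField.adjoin ℚ ({α} : Set ℂ) with hKdef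
  have hαK : α ∈ K := IntermediateField.subset_adjoin ℚ _ (Set.mem_singleton α)
  have hzK : ∀ i, z i ∈ K := by
    intro i
    obtain ⟨a, b, e⟩ := hz i
    rw [e]
    refine add_mem ?_ (mul_mem ?_ hαK)
    · simpa only [eq_ratCast] using K.algebraMap_mem a
    · simpa only [eq_ratCast] using K.algebraMap_mem b
  haveI : FiniteDimensional ℚ K := hfd
  have halg : ∀ i, IsAlgebraic ℚ (z i) := fun i =>
    IntermediateField.isAlgebraic_iff.1 (Algebra.IsAlgebraic.isAlgebraic (⟨z i, hzK i⟩ : K))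
  exact stub_borelSlice hD k z n halg him hdehn ⟨K, hfd, hzK, hKσ⟩ hsum

end imagQuadratic

end Summit.KontsevichZagierPeriods.HyperbolicBloch.ZagierDilogarithmBorelSlice

end
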